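import Summits.KontsevichZagierPeriods.KontsevichZagierPeriods.Theorems.FermatIsogenyDeepWordSectorBP4

/-! # `FermatIsogenyDeepWordSectorBP5` — part 5/7 of the mechanical ≤400-line split of `B_src.lean` (sha256 9cb321caf3c881c0…)
Source: decomp-kz lens-5 g22 DeepWordSectorB.lean v4 @d2f1e37a (levels 3/4 closed hypothesis-free, Dirichlet move proved, level 6 from the linear rung; critic CLEARED g7-5 l.1397 / g7-7 l.1406); --supports stmt-KontsevichZagierPeriods-3898.
Split by census-1 g10 `gen/splitlean.py`: scopes re-opened with their `open`/`variable`/`set_option` context; mathematics and declaration order unchanged. -/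

noncomputable section
namespace Summit.KontsevichZagierPeriods.FermatIsogeny.DeepTargets
open Literature.NumberTheory.Transcendental MeasureTheory
open Summit.KontsevichZagierPeriods.KontsevichZagierPeriods.Theses.FermatIsogeny (BetaLinearSector BetaProductSector FermatSectorComplete)
/-- Rational numbers are real algebraic. [bookkeeping] -/
private theorem isAlgebraic_ratCast (x : ℚ) : IsAlgebraic ℚ (x : ℝ) := by
  have h := isAlgebraic_algebraMap (R := ℚ) (A := ℝ) x
  rwa [eq_ratCast] at h

open Literature.NumberTheory.Transcendental MeasureTheory in
open Summit.KontsevichZagierPeriods.KontsevichZagierPeriods.Theses.FermatIsogeny (BetaLinearSector BetaProductSector FermatSectorComplete) in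
/-- Auxiliary step `isAlgebraic_two`: is Algebraic two. [bookkeeping] -/
private theorem isAlgebraic_two : IsAlgebraic ℚ (2:ℝ) := by
  simpa using isAlgebraic_ratCast 2

section LevelFourChains

/-- exponent of `X = β(½,½)` in a letter. [bookkeeping] -/
def xExp4 (x y : Fin 4) : ℕ :=
  if (x.val = 0 ∧ y.val = 2) ∨ (x.val = 2 ∧ y.val = 0) ∨ (x.val = 1 ∧ y.val = 1) then 1 else 0
/-- exponent of `Y = β(¼,½)`. [bookkeeping] -/
def yExp4 (x y : Fin 4) : ℕ :=
  if (x.val = 0 ∧ y.val = 0) ∨ (x.val = 0 ∧ y.val = 1) ∨ (x.val = 1 ∧ y.val = 0) then 1 else 0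
/-- exponent of `Z = β(¾,¾)`. [bookkeeping] -/
def zExp4 (x y : Fin 4) : ℕ :=
  if (x.val = 1 ∧ y.val = 2) ∨ (x.val = 2 ∧ y.val = 1) ∨ (x.val = 2 ∧ y.val = 2) then 1 else 0
/-- exponent of `κ(√2)`. [bookkeeping] -/
def sExp4 (x y : Fin 4) : ℕ :=
  if (x.val = 0 ∧ y.val = 0) ∨ (x.val = 0 ∧ y.val = 2) ∨ (x.val = 2 ∧ y.val = 0) ∨ (x.val = 1 ∧ y.val = 2)
    ∨ (x.val = 2 ∧ y.val = 1) then 1 else 0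
/-- the rational constant of a letter: `β(¼,1) = 4`, `β(½,1) = 2`, `β(¾,1) = 4/3`, `β(1,1) = 1`, else `1`. [bookkeeping] -/
def cst4 (x y : Fin 4) : ℚ :=
  if (x.val = 0 ∧ y.val = 3) ∨ (x.val = 3 ∧ y.val = 0) then 4
  else if (x.val = 1 ∧ y.val = 3) ∨ (x.val = 3 ∧ y.val = 1) then 2
  else if (x.val = 2 ∧ y.val = 3) ∨ (x.val = 3 ∧ y.val = 2) then 4/3 else 1

/-- Auxiliary definition `xCount4`: x Count4. [bookkeeping] -/
def xCount4 {k : ℕ} (u v : Fin k → Fin 4) : ℕ := ∑ i, xExp4 (u i) (v i)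
/-- Auxiliary definition `yCount4`: y Count4. [bookkeeping] -/
def yCount4 {k : ℕ} (u v : Fin k → Fin 4) : ℕ := ∑ i, yExp4 (u i) (v i)
/-- Auxiliary definition `zCount4`: z Count4. [bookkeeping] -/
def zCount4 {k : ℕ} (u v : Fin k → Fin 4) : ℕ := ∑ i, zExp4 (u i) (v i)
/-- Auxiliary definition `sCount4`: s Count4. [bookkeeping] -/
def sCount4 {k : ℕ} (u v : Fin k → Fin 4) : ℕ := ∑ i, sExp4 (u i) (v i)
/-- Auxiliary definition `cstW4`: cst W4. [bookkeeping] -/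
def cstW4 {k : ℕ} (u v : Fin k → Fin 4) : ℚ := ∏ i, cst4 (u i) (v i)

/-- Auxiliary step `lvl_four_val`: lvl four val. [bookkeeping] -/
theorem lvl_four_val {k : ℕ} (w : Fin k → Fin 4) (i : Fin k) :
    lvl 4 w i = if (w i).val = 0 then 1/4 else if (w i).val = 1 then 1/2 else if (w i).val = 2 then 3/4 else 1 := by
  unfold lvl
  have hlt := (w i).isLt
  split_ifs with h0 h1 h2
  · rw [h0]; norm_num
  · rw [h1]; norm_num
  · rw [h2]; norm_num
  · have h3 : (w i).val = 3 := by omega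
    rw [h3]; norm_num

/-- **The level-4 letters in `P`**: `β((x+1)/4,(y+1)/4) = κ(c_{xy})·κ(√2)^{s}·X^{[X]}·Y^{[Y]}·Z^{[Z]}`. [this node] -/
theorem letter_four {k : ℕ} (u v : Fin k → Fin 4) (i : Fin k) :
    bcl (lvl 4 u i) (lvl 4 v i) = kcQ (cst4 (u i) (v i)) * kcS ^ sExp4 (u i) (v i)
      * (bcl (1/2) (1/2) ^ xExp4 (u i) (v i) * bcl (1/4) (1/2) ^ yExp4 (u i) (v i)
        * bcl (3/4) (3/4) ^ zExp4 (u i) (v i)) := by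
  rw [lvl_four_val u i, lvl_four_val v i]
  have hu := (u i).isLt
  have hv := (v i).isLt
  have hu' : (u i).val = 0 ∨ (u i).val = 1 ∨ (u i).val = 2 ∨ (u i).val = 3 := by omega
  have hv' : (v i).val = 0 ∨ (v i).val = 1 ∨ (v i).val = 2 ∨ (v i).val = 3 := by omega
  rcases hu' with h | h | h | h <;> rcases hv' with h' | h' | h' | h' <;>
    simp only [h, h', cst4, xExp4, yExp4, zExp4, sExp4, if_true, if_false, and_true, and_false,
      or_false, or_true, pow_one, pow_zero, mul_one, one_mul, kcQ_one,
      show (0:ℕ) ≠ 1 from by decide,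
      show (0:ℕ) ≠ 2 from by decide,
      show (0:ℕ) ≠ 3 from by decide,
      show (1:ℕ) ≠ 0 from by decide,
      show (1:ℕ) ≠ 2 from by decide,
      show (1:ℕ) ≠ 3 from by decide,
      show (2:ℕ) ≠ 0 from by decide,
      show (2:ℕ) ≠ 1 from by decide,
      show (2:ℕ) ≠ 3 from by decide,
      show (3:ℕ) ≠ 0 from by decide,
      show (3:ℕ) ≠ 1 from by decide,
      show (3:ℕ) ≠ 2 from by decide,
      bcl_quarter_quarter, bcl_half_quarter, bcl_quarter_threeQuarters, bcl_threeQuarters_quarter, bcl_quarter_one,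
      bcl_one_quarter, bcl_half_threeQuarters, bcl_threeQuarters_half, bcl_half_one', bcl_one_half',
      bcl_threeQuarters_one, bcl_one_threeQuarters, bcl_one_one]

/-- **A level-4 word in `P`**: `∏ᵢ β = κ(∏ c)·κ(√2)^{#s}·(X^{#X}·Y^{#Y}·Z^{#Z})`. [this node] -/
theorem word_class_four {k : ℕ} (u v : Fin k → Fin 4) :
    ∏ i, bcl (lvl 4 u i) (lvl 4 v i)
      = kcQ (cstW4 u v) * kcS ^ sCount4 u v * (bcl (1/2) (1/2) ^ xCount4 u v * bcl (1/4) (1/2) ^ yCount4 u v * bcl (3/4) (3/4) ^ zCount4 u v) := by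
  simp_rw [letter_four u v]
  rw [Finset.prod_mul_distrib, Finset.prod_mul_distrib, Finset.prod_mul_distrib, Finset.prod_mul_distrib,
    Finset.prod_pow_eq_pow_sum, Finset.prod_pow_eq_pow_sum, Finset.prod_pow_eq_pow_sum, Finset.prod_pow_eq_pow_sum,
    kcQ_prod]
  rfl

/-- **Values of level-4 words**. [this node] -/
theorem prod_bval_four {k : ℕ} (u v : Fin k → Fin 4) :
    ∏ i, bval (lvl 4 u i) (lvl 4 v i)
      = (cstW4 u v : ℝ) * Real.sqrt 2 ^ sCount4 u v * (bval (1/2) (1/2) ^ xCount4 u v * bval (1/4) (1/2) ^ yCount4 u v * bval (3/4) (3/4) ^ zCount4 u v) := by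
  have h := congrArg KZ.evalP (word_class_four u v)
  rw [map_prod, map_mul, map_mul, map_mul, map_mul, map_pow, map_pow, map_pow, map_pow, evalP_kcQ, evalP_kcS] at h
  exact h

/-! #### DKO type 0 at level 4 in terms of letter counts -/

/-- Auxiliary step `letterInv_four_a`: letter Inv four a. [bookkeeping] -/
theorem letterInv_four_a (x y : Fin 4) :
    letterMult 4 x y 1 - letterMult 4 x y 3 = 2 * (yExp4 x y : ℤ) - 2 * zExp4 x y := by
  fin_cases x <;> fin_cases y <;> decide

/-- Auxiliary step `letterInv_four_b`: letter Inv four b. [bookkeeping] -/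
theorem letterInv_four_b (x y : Fin 4) :
    letterMult 4 x y 2 + 2 * letterMult 4 x y 3 = 2 * (xExp4 x y : ℤ) - yExp4 x y + 3 * zExp4 x y := by
  fin_cases x <;> fin_cases y <;> decide

/-- Auxiliary step `sum_letterMult_four_one`: sum letter Mult four one. [bookkeeping] -/
theorem sum_letterMult_four_one {k : ℕ} (u v : Fin k → Fin 4) :
    ∑ j, letterMult 4 (u j) (v j) 1
      = ∑ j, letterMult 4 (u j) (v j) 3 + 2 * (yCount4 u v : ℤ) - 2 * (zCount4 u v : ℤ) := by
  simp only [yCount4, zCount4, Nat.cast_sum, Finset.mul_sum, ← Finset.sum_add_distrib, ← Finset.sum_sub_distrib]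
  exact Finset.sum_congr rfl fun j _ => by linarith [letterInv_four_a (u j) (v j)]

/-- Auxiliary step `sum_letterMult_four_two`: sum letter Mult four two. [bookkeeping] -/
theorem sum_letterMult_four_two {k : ℕ} (u v : Fin k → Fin 4) :
    ∑ j, letterMult 4 (u j) (v j) 2
      = 2 * (xCount4 u v : ℤ) - (yCount4 u v : ℤ) + 3 * (zCount4 u v : ℤ) - 2 * ∑ j, letterMult 4 (u j) (v j) 3 := by
  simp only [xCount4, yCount4, zCount4, Nat.cast_sum, Finset.mul_sum, ← Finset.sum_add_distrib,
    ← Finset.sum_sub_distrib]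
  exact Finset.sum_congr rfl fun j _ => by linarith [letterInv_four_b (u j) (v j)]

/-- Auxiliary step `fract_four`: fract four. [bookkeeping] -/
theorem fract_four (w i : ℕ) :
    Int.fract ((w : ℚ) * (i : ℚ) / ((4 : ℕ) : ℚ)) = (((w * i) % 4 : ℕ) : ℚ) / ((4 : ℕ) : ℚ) := by
  rw [show (w : ℚ) * (i : ℚ) / ((4 : ℕ) : ℚ) = ((w * i : ℕ) : ℚ) / ((4 : ℕ) : ℚ) by push_cast; ring]
  exact Int.fract_div_natCast_eq_div_natCast_mod

/-- At level 4 a Γ-vector has DKO type 0 iff `n₁ = n₃` and `n₂ + 2n₃ = 0`. [this node] -/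
theorem hodgeType_four_iff (p : ℕ → ℤ) : IsHodgeTypeGammaMonomial 4 p 0 ↔ (p 1 = p 3 ∧ p 2 + 2 * p 3 = 0) := by
  constructor
  · intro h
    have e1 := h 1 (by decide)
    have e3 := h 3 (by decide)
    rw [sum_Ico_one_four, fract_four, fract_four, fract_four] at e1 e3
    norm_num at e1 e3
    have i1 : ((p 1 : ℤ) : ℚ) = p 3 := by linarith
    have i2 : ((p 2 : ℤ) : ℚ) + 2 * p 3 = 0 := by linarith
    exact ⟨by exact_mod_cast i1, by exact_mod_cast i2⟩
  · rintro ⟨h1, h2⟩ w hw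
    rw [sum_Ico_one_four, fract_four, fract_four, fract_four]
    have q1 : ((p 1 : ℤ) : ℚ) = p 3 := by exact_mod_cast h1
    have q2 : ((p 2 : ℤ) : ℚ) + 2 * p 3 = 0 := by exact_mod_cast h2
    have hw' : w % 4 = 1 ∨ w % 4 = 3 := by
      have h2 : ¬ 2 ∣ w := fun hd => absurd (Nat.Coprime.coprime_dvd_left hd hw) (by decide)
      omega
    rcases hw' with hw1 | hw3
    · have a1 : (w * 1) % 4 = 1 := by omega
      have a2 : (w * 2) % 4 = 2 := by omega
      have a3 : (w * 3) % 4 = 3 := by omega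
      rw [a1, a2, a3]; push_cast
      linear_combination (q1 + 2 * q2) / 4
    · have a1 : (w * 1) % 4 = 3 := by omega
      have a2 : (w * 2) % 4 = 2 := by omega
      have a3 : (w * 3) % 4 = 1 := by omega
      rw [a1, a2, a3]; push_cast
      linear_combination (3 * q1 + 2 * q2) / 4

/-- **DKO type 0 at level 4 = the two count identities of level 3**: `#X + #Z` and `#Y − #Z` agree. [this node] -/
theorem sameType_four_iff {k : ℕ} (u v u' v' : Fin k → Fin 4) :
    SameType 4 u v u' v' ↔
      (xCount4 u v + zCount4 u v = xCount4 u' v' + zCount4 u' v' ∧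
        yCount4 u v + zCount4 u' v' = yCount4 u' v' + zCount4 u v) := by
  unfold SameType
  rw [hodgeType_four_iff]
  simp only [pairMult, sum_letterMult_four_one, sum_letterMult_four_two]
  omega

/-! #### the chain theorem -/

/-- **LEVEL-4 CHAINS, UNCONDITIONALLY**: `BoxChain k 4 (SameType 4)` for every word length `k`. [this node] -/
theorem boxChain_four (k : ℕ) : BoxChain k 4 (SameType 4) := by
  intro u v u' v' hT q hq r r' hr hi hr' hi' hv
  have h4 : (0:ℕ) < 4 := by norm_num
  have hab : ∀ j, 0 < lvl 4 u j ∧ 0 < lvl 4 v j := fun j => ⟨(lvl_bounds h4 u j).1, (lvl_bounds h4 v j).1⟩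
  have hab' : ∀ j, 0 < lvl 4 u' j ∧ 0 < lvl 4 v' j := fun j => ⟨(lvl_bounds h4 u' j).1, (lvl_bounds h4 v' j).1⟩
  obtain ⟨hxz, hyz⟩ := (sameType_four_iff u v u' v').mp hT
  -- values
  have vX : 0 < bval (1/2) (1/2) := bval_pos (by norm_num) (by norm_num)
  have vY : 0 < bval (1/4) (1/2) := bval_pos (by norm_num) (by norm_num)
  have vZ : 0 < bval (3/4) (3/4) := bval_pos (by norm_num) (by norm_num)
  have vS : 0 < Real.sqrt 2 := Real.sqrt_pos.mpr two_pos
  have vT : 0 < 2 * Real.sqrt 2 := twoSqrtTwo_pos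
  have vr : r.value = (cstW4 u v : ℝ) * Real.sqrt 2 ^ sCount4 u v * (bval (1/2) (1/2) ^ xCount4 u v * bval (1/4) (1/2) ^ yCount4 u v * bval (3/4) (3/4) ^ zCount4 u v) := by
    rw [word_value _ _ hab r hr hi, prod_bval_four]
  have vr' : r'.value = q * ((cstW4 u' v' : ℝ) * Real.sqrt 2 ^ sCount4 u' v' * (bval (1/2) (1/2) ^ xCount4 u' v' * bval (1/4) (1/2) ^ yCount4 u' v' * bval (3/4) (3/4) ^ zCount4 u' v')) := by
    rw [word_value_const q hq _ _ hab' r' hr' hi', prod_bval_four]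
  have hWv : (2 * Real.sqrt 2) ^ zCount4 u' v' * (bval (1/2) (1/2) ^ xCount4 u v * bval (1/4) (1/2) ^ yCount4 u v * bval (3/4) (3/4) ^ zCount4 u v)
      = (2 * Real.sqrt 2) ^ zCount4 u v * (bval (1/2) (1/2) ^ xCount4 u' v' * bval (1/4) (1/2) ^ yCount4 u' v' * bval (3/4) (3/4) ^ zCount4 u' v') :=
    nf3 dirichlet_four_rel_values hxz hyz
  have hW0 : (2 * Real.sqrt 2) ^ zCount4 u' v' * (bval (1/2) (1/2) ^ xCount4 u v * bval (1/4) (1/2) ^ yCount4 u v * bval (3/4) (3/4) ^ zCount4 u v) ≠ 0 := by positivity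
  -- the constants: `c·√2^s·T^z = q·c'·√2^{s'}·T^{z'}`
  have key : (cstW4 u v : ℝ) * Real.sqrt 2 ^ sCount4 u v * (2 * Real.sqrt 2) ^ zCount4 u v
      = q * ((cstW4 u' v' : ℝ) * Real.sqrt 2 ^ sCount4 u' v') * (2 * Real.sqrt 2) ^ zCount4 u' v' := by
    have e : (cstW4 u v : ℝ) * Real.sqrt 2 ^ sCount4 u v * (bval (1/2) (1/2) ^ xCount4 u v * bval (1/4) (1/2) ^ yCount4 u v * bval (3/4) (3/4) ^ zCount4 u v)
        = q * ((cstW4 u' v' : ℝ) * Real.sqrt 2 ^ sCount4 u' v') * (bval (1/2) (1/2) ^ xCount4 u' v' * bval (1/4) (1/2) ^ yCount4 u' v' * bval (3/4) (3/4) ^ zCount4 u' v') := by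
      have := hv; rw [vr, vr'] at this; linear_combination this
    apply mul_right_cancel₀ hW0
    calc (cstW4 u v : ℝ) * Real.sqrt 2 ^ sCount4 u v * (2 * Real.sqrt 2) ^ zCount4 u v
            * ((2 * Real.sqrt 2) ^ zCount4 u' v' * (bval (1/2) (1/2) ^ xCount4 u v * bval (1/4) (1/2) ^ yCount4 u v * bval (3/4) (3/4) ^ zCount4 u v))
          = ((cstW4 u v : ℝ) * Real.sqrt 2 ^ sCount4 u v * (bval (1/2) (1/2) ^ xCount4 u v * bval (1/4) (1/2) ^ yCount4 u v * bval (3/4) (3/4) ^ zCount4 u v))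
            * (2 * Real.sqrt 2) ^ zCount4 u v * (2 * Real.sqrt 2) ^ zCount4 u' v' := by ring
      _ = (q * ((cstW4 u' v' : ℝ) * Real.sqrt 2 ^ sCount4 u' v') * (bval (1/2) (1/2) ^ xCount4 u' v' * bval (1/4) (1/2) ^ yCount4 u' v' * bval (3/4) (3/4) ^ zCount4 u' v'))
            * (2 * Real.sqrt 2) ^ zCount4 u v * (2 * Real.sqrt 2) ^ zCount4 u' v' := by rw [e]
      _ = q * ((cstW4 u' v' : ℝ) * Real.sqrt 2 ^ sCount4 u' v') * (2 * Real.sqrt 2) ^ zCount4 u' v'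
            * ((2 * Real.sqrt 2) ^ zCount4 u v * (bval (1/2) (1/2) ^ xCount4 u' v' * bval (1/4) (1/2) ^ yCount4 u' v' * bval (3/4) (3/4) ^ zCount4 u' v')) := by ring
      _ = q * ((cstW4 u' v' : ℝ) * Real.sqrt 2 ^ sCount4 u' v') * (2 * Real.sqrt 2) ^ zCount4 u' v'
            * ((2 * Real.sqrt 2) ^ zCount4 u' v' * (bval (1/2) (1/2) ^ xCount4 u v * bval (1/4) (1/2) ^ yCount4 u v * bval (3/4) (3/4) ^ zCount4 u v)) := by rw [hWv]
  -- classes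
  have hWP : kcT ^ zCount4 u' v' * (bcl (1/2) (1/2) ^ xCount4 u v * bcl (1/4) (1/2) ^ yCount4 u v * bcl (3/4) (3/4) ^ zCount4 u v) = kcT ^ zCount4 u v * (bcl (1/2) (1/2) ^ xCount4 u' v' * bcl (1/4) (1/2) ^ yCount4 u' v' * bcl (3/4) (3/4) ^ zCount4 u' v') :=
    nf3 dirichlet_four_rel hxz hyz
  have hW2 : (bcl (1/2) (1/2) ^ xCount4 u' v' * bcl (1/4) (1/2) ^ yCount4 u' v' * bcl (3/4) (3/4) ^ zCount4 u' v')
      = kcTi ^ zCount4 u v * kcT ^ zCount4 u' v' * (bcl (1/2) (1/2) ^ xCount4 u v * bcl (1/4) (1/2) ^ yCount4 u v * bcl (3/4) (3/4) ^ zCount4 u v) := by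
    calc (bcl (1/2) (1/2) ^ xCount4 u' v' * bcl (1/4) (1/2) ^ yCount4 u' v' * bcl (3/4) (3/4) ^ zCount4 u' v')
          = (kcT * kcTi) ^ zCount4 u v * (bcl (1/2) (1/2) ^ xCount4 u' v' * bcl (1/4) (1/2) ^ yCount4 u' v' * bcl (3/4) (3/4) ^ zCount4 u' v') := by rw [kcT_mul_kcTi, one_pow, one_mul]
      _ = kcTi ^ zCount4 u v * (kcT ^ zCount4 u v * (bcl (1/2) (1/2) ^ xCount4 u' v' * bcl (1/4) (1/2) ^ yCount4 u' v' * bcl (3/4) (3/4) ^ zCount4 u' v')) := by rw [mul_pow]; ring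
      _ = kcTi ^ zCount4 u v * (kcT ^ zCount4 u' v' * (bcl (1/2) (1/2) ^ xCount4 u v * bcl (1/4) (1/2) ^ yCount4 u v * bcl (3/4) (3/4) ^ zCount4 u v)) := by rw [hWP]
      _ = _ := by ring
  have er : KZ.toFormalPeriod (KZ.of r) = (kcQ (cstW4 u v) * kcS ^ sCount4 u v) * (bcl (1/2) (1/2) ^ xCount4 u v * bcl (1/4) (1/2) ^ yCount4 u v * bcl (3/4) (3/4) ^ zCount4 u v) := by
    rw [word_class _ _ hab r hr hi, word_class_four]
  have er' : KZ.toFormalPeriod (KZ.of r')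
      = (kc q hq * (kcQ (cstW4 u' v') * kcS ^ sCount4 u' v') * kcTi ^ zCount4 u v * kcT ^ zCount4 u' v') * (bcl (1/2) (1/2) ^ xCount4 u v * bcl (1/4) (1/2) ^ yCount4 u v * bcl (3/4) (3/4) ^ zCount4 u v) := by
    rw [word_class_const q hq _ _ hab' r' hr' hi', word_class_four, hW2]; ring
  have hsc : kc q hq * (kcQ (cstW4 u' v') * kcS ^ sCount4 u' v') * kcTi ^ zCount4 u v * kcT ^ zCount4 u' v'
      = kcQ (cstW4 u v) * kcS ^ sCount4 u v := by
    rw [kcQ, kcQ, kcS, kcT, kcTi, kc_pow, kc_pow, kc_pow, kc_pow, ← kc_mul, ← kc_mul, ← kc_mul, ← kc_mul, ← kc_mul]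
    refine kc_congr _ _ ?_
    have hTi : ((2 * Real.sqrt 2)⁻¹) ^ zCount4 u v * (2 * Real.sqrt 2) ^ zCount4 u v = 1 := by
      rw [← mul_pow, inv_mul_cancel₀ vT.ne', one_pow]
    linear_combination (-(((2 * Real.sqrt 2)⁻¹) ^ zCount4 u v)) * key
      + ((cstW4 u v : ℝ) * Real.sqrt 2 ^ sCount4 u v) * hTi
  have e : KZ.toFormalPeriod (KZ.of r) = KZ.toFormalPeriod (KZ.of r') := by rw [er, er', hsc]
  show KZ.of r - KZ.of r' ∈ KZ.relations
  exact KZ.toFormalPeriod_eq_iff.mp e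

/-- **LEVEL 4 OF EVERY SECTOR = ITS SHADOW**: `RohrlichHodgeAt 4 → ∀ k, Box(k,4)`. [this node] -/
theorem betaWordSectorLevel_four_of_rohrlichHodgeAt (hR : RohrlichHodgeAt 4) (k : ℕ) : BetaWordSectorLevel k 4 :=
  (betaWordSectorLevel_iff_of_rohrlichHodgeAt (by norm_num) hR k).mpr (boxChain_four k)

/-- With Chudnovsky's theorem for `Γ(¼), π` typed faithfully: `ChudnovskyGammaQuarter → ∀ k, BetaWordSectorLevel k 4`.
[this node] -/
theorem betaWordSectorLevel_four_of_chudnovsky (h : ChudnovskyGammaQuarter) (k : ℕ) : BetaWordSectorLevel k 4 :=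
  (betaWordSectorLevel_four_iff_of_chudnovsky h k).mpr (boxChain_four k)

/-- **Crux 3898 after levels 3 and 4**: modulo the two Chudnovsky theorems (tree, pending build), `BetaProductSector` is the ONE
finite chain statement `BoxChain 2 6 (SameType 6)` plus the levels `N = 5, N ≥ 7`. [this node] -/
theorem betaProductSector_iff_level_six_of_chudnovsky (h3 : ChudnovskyGammaThird) (h4 : ChudnovskyGammaQuarter) :
    Summit.KontsevichZagierPeriods.KontsevichZagierPeriods.Theses.FermatIsogeny.BetaProductSector ↔
      (BoxChain 2 6 (SameType 6) ∧ ∀ N, 3 ≤ N → N ≠ 3 → N ≠ 4 → N ≠ 6 → BetaWordSectorLevel 2 N) := by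
  rw [betaProductSector_iff_of_chudnovsky h3 h4]
  have hc : BoxChain 2 4 (SameType 4) := boxChain_four 2
  constructor
  · rintro ⟨⟨_, h6⟩, H⟩; exact ⟨h6, H⟩
  · rintro ⟨h6, H⟩; exact ⟨⟨hc, h6⟩, H⟩

/-- `Γ(¼)Γ(¾) = √2·π` on values, read off the class identity `bcl_quarter_threeQuarters` (`B(¼,¾) = √2·B(½,½)`). [folklore] -/
theorem bval_quarter_threeQuarters : bval (1/4) (3/4) = Real.sqrt 2 * bval (1/2) (1/2) := by
  have h := congrArg KZ.evalP bcl_quarter_threeQuarters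
  rw [map_mul, evalP_kcS] at h
  exact h

end LevelFourChains

/-!
### ADDENDUM 6 — LEVEL 6 OF EVERY BETA-WORD SECTOR FROM THE ROUTE'S LINEAR RUNG: `BetaLinearSixths → ∀ k, BoxChain k 6 (SameType 6)`

Dirichlet (`bcl_dirichlet`) and Legendre (`bcl_dup`) alone cannot isolate the six `⅙`-letters or produce Euler reflection at `⅓` in `P`
(both would need a cancellation, which is not a KZ rule).  The route's OWN linear rung at level 6 — the TREE THEOREM
`BetaLinearSector.SixthsMax.betaLinearSector_sixths` (`Theorems/FermatIsogenyBetaLinearSectorSixthsMax.lean`, proved, sorry-free; module not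
built on the farm today) — supplies exactly the missing letter coincidences (CM `3`-isogeny `β(⅙,½) ∼ √3·β(⅓,½)`, the Legendre and Euler
letters).  Typed verbatim as the hypothesis `BetaLinearSixths`, it gives: every level-6 letter is `κ(c)·κ(√3)^r·κ(2^{1/3})^w·X^x A^y C^z` in `P`
with `X = β(½,½)`, `A = β(⅓,½)`, `C = β(⅔,½)` and the one relation `A·C = κ(2√3)·X` (Dirichlet at `(⅙,½,½)`); DKO type `0` at level 6 is
`Σ nᵢ = 0 ∧ Σ i·nᵢ = 0` (`hodgeType_six_iff`), i.e. the two count identities of `nf3` (`sameType_six_iff`).  Hence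
**LINEAR ⇒ ALL WORD LENGTHS at level 6** (`boxChain_six_of_linear`), and crux 3898 becomes the PURE Rohrlich shadow `N = 5, N ≥ 7`
modulo three tree theorems pending build (`betaProductSector_iff_shadow_of_chudnovsky_linear`).
-/

section LevelSixChains

/-- NAMED HYPOTHESIS — **the route's linear rung at level 6**, VERBATIM the statement of the TREE THEOREM
`Summit.KontsevichZagierPeriods.FermatIsogeny.BetaLinearSector.SixthsMax.betaLinearSector_sixths`
(`Theorems/FermatIsogenyBetaLinearSectorSixthsMax.lean`; proved there from the sixths normal forms, the CM `3`-isogeny chain and Euler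
reflection; its module is not built on the farm today, so it is carried as a hypothesis and discharged by `exact betaLinearSector_sixths`
once it builds). [tree theorem, cited by name] -/
def BetaLinearSixths : Prop :=
  ∀ (a b a' b' : ℚ) (c : ℝ), 0 < a → 0 < b → 0 < a' → 0 < b' → IsAlgebraic ℚ c →
    (∃ m : ℤ, a = m / 6) → (∃ m : ℤ, b = m / 6) → (∃ m : ℤ, a' = m / 6) → (∃ m : ℤ, b' = m / 6) →
    ∀ (r r' : KZ.IntegralRep 1),
      r.domain = {x | x 0 ∈ Set.Ioo (0:ℝ) 1} →
      Set.EqOn r.integrand (fun x => (x 0) ^ ((a:ℝ) - 1) * (1 - x 0) ^ ((b:ℝ) - 1)) r.domain →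
      r'.domain = {x | x 0 ∈ Set.Ioo (0:ℝ) 1} →
      Set.EqOn r'.integrand (fun x => c * (x 0) ^ ((a':ℝ) - 1) * (1 - x 0) ^ ((b':ℝ) - 1)) r'.domain →
      r.value = r'.value → KZ.Equivalent r r'

/-- **Transfer from the linear rung to `P`**: two level-6 letters whose values differ by the algebraic factor `q` differ by `κ(q)` in `P`.
[this node] -/
theorem bcl_eq_kc_mul_of_linear (h6 : BetaLinearSixths) {a b a' b' : ℚ} (ha : 0 < a) (hb : 0 < b) (ha' : 0 < a') (hb' : 0 < b')
    (hma : ∃ m : ℤ, a = m / 6) (hmb : ∃ m : ℤ, b = m / 6) (hma' : ∃ m : ℤ, a' = m / 6) (hmb' : ∃ m : ℤ, b' = m / 6)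
    {q : ℝ} (hq : IsAlgebraic ℚ q) (hv : bval a b = q * bval a' b') :
    bcl a b = kc q hq * bcl a' b' := by
  have e : KZ.Equivalent (bRep a b ha hb) ((bRep a' b' ha' hb').constMul q hq) := by
    refine h6 a b a' b' q ha hb ha' hb' hq hma hmb hma' hmb' _ _ (bRep_domain a b ha hb) (bRep_integrand a b ha hb)
      (bRep_domain a' b' ha' hb') ?_ ?_
    · intro x hx
      rw [KZ.IntegralRep.integrand_constMul]
      show q * (bRep a' b' ha' hb').integrand x = _
      rw [bRep_integrand a' b' ha' hb' hx]; ring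
    · have h1 : (bRep a b ha hb).value = bval a b := by rw [bval, bcl_eq ha hb, KZ.evalP_toFormalPeriod_of]
      have h2 : ((bRep a' b' ha' hb').constMul q hq).value = q * bval a' b' := by
        rw [KZ.IntegralRep.value_constMul, bval, bcl_eq ha' hb', KZ.evalP_toFormalPeriod_of]
      rw [h1, h2, hv]
  calc bcl a b = KZ.toFormalPeriod (KZ.of (bRep a b ha hb)) := bcl_eq ha hb
    _ = KZ.toFormalPeriod (KZ.of ((bRep a' b' ha' hb').constMul q hq)) := e.toFormalPeriod_eq
    _ = kc q hq * bcl a' b' := by rw [toFormalPeriod_constMul, ← bcl_eq ha' hb']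

/-! #### the constants `√3`, `W = 2^{1/3}`, `2√3` -/

/-- `W = 2^{1/3}`. [bookkeeping] -/
noncomputable def cW : ℝ := (2:ℝ) ^ ((1:ℝ)/3)

/-- Auxiliary step `cW_pos`: c W pos. [bookkeeping] -/
theorem cW_pos : 0 < cW := Real.rpow_pos_of_pos two_pos _

/-- Auxiliary step `cW_pow_three`: c W pow three. [bookkeeping] -/
theorem cW_pow_three : cW ^ 3 = 2 := by
  rw [cW, ← Real.rpow_natCast, ← Real.rpow_mul zero_le_two,
    show (1:ℝ)/3 * ((3:ℕ):ℝ) = ((1:ℕ):ℝ) by norm_num, Real.rpow_natCast, pow_one]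

/-- Auxiliary step `cW_sq`: c W sq. [bookkeeping] -/
theorem cW_sq : cW ^ 2 = (2:ℝ) ^ ((2:ℝ)/3) := by
  rw [cW, ← Real.rpow_natCast, ← Real.rpow_mul zero_le_two]
  norm_num

/-- Auxiliary step `isAlgebraic_cW`: is Algebraic c W. [bookkeeping] -/
theorem isAlgebraic_cW : IsAlgebraic ℚ cW := by
  refine ⟨Polynomial.X ^ 3 - Polynomial.C 2, Polynomial.X_pow_sub_C_ne_zero (by norm_num) _, ?_⟩
  simp [cW_pow_three]

/-- Auxiliary step `isAlgebraic_sqrt_three`: is Algebraic sqrt three. [bookkeeping] -/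
private theorem isAlgebraic_sqrt_three : IsAlgebraic ℚ (Real.sqrt 3) := by simpa using isAlgebraic_sqrt_nat 3

/-- Auxiliary step `sqrt_three_pos`: sqrt three pos. [bookkeeping] -/
private theorem sqrt_three_pos : 0 < Real.sqrt 3 := Real.sqrt_pos.mpr (by norm_num)

/-- Auxiliary step `twoSqrtThree_pos`: two Sqrt Three pos. [bookkeeping] -/
theorem twoSqrtThree_pos : 0 < 2 * Real.sqrt 3 := by positivity

/-- `κ(√3)`, `κ(2^{1/3})`, `κ(2√3)`, `κ((2√3)⁻¹)`. [bookkeeping] -/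
noncomputable def kcR : KZ.FormalPeriodRing := kc (Real.sqrt 3) isAlgebraic_sqrt_three
/-- Auxiliary definition `kcW`: kc W. [bookkeeping] -/
noncomputable def kcW : KZ.FormalPeriodRing := kc cW isAlgebraic_cW
/-- Auxiliary definition `kcT6`: kc T6. [bookkeeping] -/
noncomputable def kcT6 : KZ.FormalPeriodRing := kc (2 * Real.sqrt 3) (isAlgebraic_two.mul isAlgebraic_sqrt_three)
/-- Auxiliary definition `kcT6i`: kc T6i. [bookkeeping] -/
noncomputable def kcT6i : KZ.FormalPeriodRing := kc (2 * Real.sqrt 3)⁻¹ (isAlgebraic_two.mul isAlgebraic_sqrt_three).inv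

/-- Auxiliary step `evalP_kcR`: eval P kc R. [bookkeeping] -/
@[simp] theorem evalP_kcR : KZ.evalP kcR = Real.sqrt 3 := evalP_kc _ _
/-- Auxiliary step `evalP_kcW`: eval P kc W. [bookkeeping] -/
@[simp] theorem evalP_kcW : KZ.evalP kcW = cW := evalP_kc _ _
/-- Auxiliary step `evalP_kcT6`: eval P kc T6. [bookkeeping] -/
@[simp] theorem evalP_kcT6 : KZ.evalP kcT6 = 2 * Real.sqrt 3 := evalP_kc _ _

/-- Auxiliary step `kcT6_mul_kcT6i`: kc T6 mul kc T6i. [bookkeeping] -/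
theorem kcT6_mul_kcT6i : kcT6 * kcT6i = 1 := kc_mul_kc_inv _ twoSqrtThree_pos.ne'

/-! #### the Γ-facts at level 6: reflections at `⅓`, `⅙`, Legendre at `⅙`, `⅓` -/

end LevelSixChains
end Summit.KontsevichZagierPeriods.FermatIsogeny.DeepTargets
end
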